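import Mathlib
import Literature.Analysis.FluidPDE.HelicityDensityTransport
import Summits.NavierStokesRegularity.NavierStokesRegularity.Theorems.ThreadingFluxHorizonTowerHarmonicCubic
import HarnessLib

/-!
# Crux `PoloidalLiouville` (stmt-NavierStokesRegularity-1222, wall W1), crux idea «steady-centre-sieve» (ns-idea-15 g5,
# `Cruxes/PoloidalLiouville/CentreJetSketch.lean`): the kinematics of the centre `CentreVorticityJet` (E1), body VERBATIM

Support file (Theorems-side; seat ns-wall-eng-7 g4, cell ns-wall-extremal, W1 adjunct; `--supports
stmt-NavierStokesRegularity-1222 --as helper`).  (E1, S) of the steady centre-jet sieve: if `V ∈ C³(ℝ³; ℝ³)` is UNTHREADED about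
`x₀` — `⟪x − x₀, curl V x⟫ = 0` for every `x` — then at the centre the vorticity `ω = curl V` VANISHES, its gradient is SKEW
(`⟪y, ∇ω(x₀) y⟫ = 0`), and its Laplacian vanishes: the orders 1, 2, 3 of `⟪y, ω(x₀ + y)⟫ ≡ 0`.

Proof (kernel, no coordinates): for a continuous field `W` with `⟪x − x₀, W x⟫ ≡ 0`, restricting to the line `x₀ + t a` gives
`t ⟪a, W(x₀ + t a)⟫ = 0`, so `⟪a, W(x₀ + t a)⟫ = 0` for `t ≠ 0` and, by continuity, at `t = 0`; hence `W x₀ = 0`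
(`eq_zero_of_inner_sub_eq_zero`).  Differentiating the identically vanishing `t ↦ ⟪y, W(x₀ + t y)⟫` at `t = 0` gives the skewness
(`inner_fderiv_self_eq_zero_of_inner_sub_eq_zero`).  For the Laplacian: `Ψ(x) = ⟪x − x₀, W x⟫ ≡ 0` has `ΔΨ = 2 div W + ⟪x − x₀, ΔW⟫`
(line second derivatives, `laplacian_inner_sub_eq`), and `div curl V = 0`, so `⟪x − x₀, Δω x⟫ ≡ 0` and the first step applies to the
continuous field `Δω`.

* `CentreJet.centreVorticityJet` — body of the sketch's `CentreVorticityJet` verbatim (`IsUnthreadedAbout x₀ V` unfolded; Theorems cannot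
  import the crux workfile; by-name glue follows once a Theorems-side Defs twin exists).

HONEST LABEL: elementary calculus about typed objects of one crux idea; the card's conjectures, its target `SteadyUnthreadedLiouville`, the
crux `PoloidalLiouville` (1222) and NS regularity remain OPEN and untouched; information-grade for W1 (movement 0).
[cite: MajdaBertozziCUP2002, §1.1 (vector identities)]
-/

-- the summit and its single problem share the name (D-0017 nested layout)
set_option linter.dupNamespace false

noncomputable section

open Set Function Filter
open scoped RealInnerProductSpace Topology
open Literature.Analysis.FluidPDE

namespace Summit.NavierStokesRegularity.NavierStokesRegularity.Theorems.PoloidalLiouville.CentreJet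

/-! ### Order one: a continuous field with `⟪x − x₀, W x⟫ ≡ 0` vanishes at the centre -/

/-- If `W` is continuous at `x₀` and `⟪x − x₀, W x⟫ = 0` for all `x`, then `W x₀ = 0` (restrict to the lines through `x₀`). -/
theorem eq_zero_of_inner_sub_eq_zero {W : EuclideanSpace ℝ (Fin 3) → EuclideanSpace ℝ (Fin 3)}
    {x₀ : EuclideanSpace ℝ (Fin 3)} (hW : ContinuousAt W x₀)
    (h : ∀ x, ⟪x - x₀, W x⟫ = 0) : W x₀ = 0 := by
  have key : ∀ a : EuclideanSpace ℝ (Fin 3), ⟪a, W x₀⟫ = 0 := by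
    intro a
    -- `g t = ⟪a, W (x₀ + t a)⟫` vanishes for `t ≠ 0` and is continuous at `0`
    have hg0 : ∀ t : ℝ, t ≠ 0 → ⟪a, W (x₀ + t • a)⟫ = 0 := by
      intro t ht
      have ht' := h (x₀ + t • a)
      rw [add_sub_cancel_left, real_inner_smul_left] at ht'
      rcases mul_eq_zero.1 ht' with h1 | h1
      · exact absurd h1 ht
      · exact h1
    have hcont : ContinuousAt (fun t : ℝ => ⟪a, W (x₀ + t • a)⟫) 0 := by
      have h1 : ContinuousAt (fun t : ℝ => x₀ + t • a) 0 :=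
        (continuousAt_const.add (continuousAt_id.smul continuousAt_const))
      have h2 : ContinuousAt W ((fun t : ℝ => x₀ + t • a) 0) := by simpa using hW
      exact continuousAt_const.inner (ContinuousAt.comp h2 h1)
    have hlim : Tendsto (fun t : ℝ => ⟪a, W (x₀ + t • a)⟫) (𝓝[≠] (0 : ℝ)) (𝓝 ⟪a, W (x₀ + (0 : ℝ) • a)⟫) :=
      hcont.tendsto.mono_left nhdsWithin_le_nhds
    have hlim0 : Tendsto (fun t : ℝ => ⟪a, W (x₀ + t • a)⟫) (𝓝[≠] (0 : ℝ)) (𝓝 0) :=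
      tendsto_const_nhds.congr' (eventually_nhdsWithin_of_forall fun t ht => (hg0 t ht).symm)
    have h0 := tendsto_nhds_unique hlim hlim0
    simpa using h0
  exact inner_self_eq_zero.1 (key (W x₀))

/-! ### Order two: the gradient at the centre is skew -/

/-- If `W ∈ C¹` and `⟪x − x₀, W x⟫ = 0` for all `x`, then `⟪y, DW(x₀) y⟫ = 0` for every `y`. -/
theorem inner_fderiv_self_eq_zero_of_inner_sub_eq_zero {W : EuclideanSpace ℝ (Fin 3) → EuclideanSpace ℝ (Fin 3)}
    {x₀ : EuclideanSpace ℝ (Fin 3)} (hW : ContDiff ℝ 1 W)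
    (h : ∀ x, ⟪x - x₀, W x⟫ = 0) (y : EuclideanSpace ℝ (Fin 3)) : ⟪y, fderiv ℝ W x₀ y⟫ = 0 := by
  have hW0 : W x₀ = 0 := eq_zero_of_inner_sub_eq_zero hW.continuous.continuousAt h
  -- `t ↦ ⟪y, W (x₀ + t y)⟫` vanishes identically
  have hg : (fun t : ℝ => ⟪y, W (x₀ + t • y)⟫) = fun _ => 0 := by
    funext t
    by_cases ht : t = 0
    · simp [ht, hW0]
    · have ht' := h (x₀ + t • y)
      rw [add_sub_cancel_left, real_inner_smul_left] at ht'
      rcases mul_eq_zero.1 ht' with h1 | h1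
      · exact absurd h1 ht
      · exact h1
  -- and has derivative `⟪y, DW(x₀) y⟫` at `t = 0`
  have hline : HasDerivAt (fun t : ℝ => x₀ + t • y) y 0 := by
    simpa using ((hasDerivAt_id (0 : ℝ)).smul_const y).const_add x₀
  have hWd : HasFDerivAt W (fderiv ℝ W x₀) (x₀ + (0 : ℝ) • y) := by
    simpa using ((hW.differentiable one_ne_zero) x₀).hasFDerivAt
  have hcomp : HasDerivAt (fun t : ℝ => W (x₀ + t • y)) (fderiv ℝ W x₀ y) 0 :=
    hWd.comp_hasDerivAt (0 : ℝ) hline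
  have hinner : HasDerivAt (fun t : ℝ => ⟪y, W (x₀ + t • y)⟫) ⟪y, fderiv ℝ W x₀ y⟫ 0 := by
    simpa using (hasDerivAt_const (0 : ℝ) y).inner ℝ hcomp
  have hzero : HasDerivAt (fun t : ℝ => ⟪y, W (x₀ + t • y)⟫) 0 0 := by
    rw [hg]
    exact hasDerivAt_const 0 0
  exact hinner.unique hzero

/-! ### Order three: `Δ⟪x − x₀, W⟫ = 2 div W + ⟪x − x₀, ΔW⟫` -/

section LineCalculus

variable {W : EuclideanSpace ℝ (Fin 3) → EuclideanSpace ℝ (Fin 3)}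

/-- Along a line, a `C²` field composed with a fixed linear functional: `(d/dt)²|₀ ⟪a, W(x + t e)⟫ = ⟪a, D²W(x)(e,e)⟫`. -/
theorem iteratedDeriv_two_inner_const_line (hW : ContDiff ℝ 2 W) (a x e : EuclideanSpace ℝ (Fin 3)) :
    iteratedDeriv 2 (fun t : ℝ => ⟪a, W (x + t • e)⟫) 0 = ⟪a, iteratedFDeriv ℝ 2 W x ![e, e]⟫ := by
  have hF : ContDiff ℝ 2 (fun z : EuclideanSpace ℝ (Fin 3) => ⟪a, W z⟫) := contDiff_const.inner ℝ hW
  rw [← HorizonTower.iteratedFDeriv_two_eq_iteratedDeriv_line hF x e]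
  have hcomp : (fun z : EuclideanSpace ℝ (Fin 3) => ⟪a, W z⟫) = (innerSL ℝ a) ∘ W := by
    funext z
    simp
  rw [hcomp, (innerSL ℝ a).iteratedFDeriv_comp_left hW.contDiffAt (i := 2) (by exact_mod_cast le_rfl)]
  simp

/-- `(d/dt)|₀ ⟪a, W(x + t e)⟫ = ⟪a, DW(x) e⟫` for differentiable `W`. -/
theorem hasDerivAt_inner_const_line (hW : Differentiable ℝ W) (a x e : EuclideanSpace ℝ (Fin 3)) (t : ℝ) :
    HasDerivAt (fun s : ℝ => ⟪a, W (x + s • e)⟫) ⟪a, fderiv ℝ W (x + t • e) e⟫ t := by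
  have hline : HasDerivAt (fun s : ℝ => x + s • e) e t := by
    simpa using ((hasDerivAt_id t).smul_const e).const_add x
  have hc : HasDerivAt (fun s : ℝ => W (x + s • e)) (fderiv ℝ W (x + t • e) e) t :=
    (hW (x + t • e)).hasFDerivAt.comp_hasDerivAt t hline
  simpa using (hasDerivAt_const t a).inner ℝ hc

/-- `(d/dt)²|₀ (t · ⟪e, W(x + t e)⟫) = 2 ⟪e, DW(x) e⟫` for `W ∈ C²`. -/
theorem iteratedDeriv_two_mul_inner_line (hW : ContDiff ℝ 2 W) (x e : EuclideanSpace ℝ (Fin 3)) :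
    iteratedDeriv 2 (fun t : ℝ => t * ⟪e, W (x + t • e)⟫) 0 = 2 * ⟪e, fderiv ℝ W x e⟫ := by
  have hWd : Differentiable ℝ W := hW.differentiable (by norm_num)
  -- `φ t = ⟪e, W(x + t e)⟫` and its derivative
  set φ : ℝ → ℝ := fun t => ⟪e, W (x + t • e)⟫ with hφ
  have hφd : ∀ t, HasDerivAt φ ⟪e, fderiv ℝ W (x + t • e) e⟫ t := fun t => hasDerivAt_inner_const_line hWd e x e t
  have hφ' : deriv φ = fun t => ⟪e, fderiv ℝ W (x + t • e) e⟫ := funext fun t => (hφd t).deriv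
  -- `φ'` is differentiable (W ∈ C²)
  have hDW : Differentiable ℝ (fun z => fderiv ℝ W z e) :=
    ((hW.fderiv_right (m := 1) (by norm_num)).differentiable one_ne_zero).clm_apply (differentiable_const _)
  have hφ'd : DifferentiableAt ℝ (deriv φ) 0 := by
    rw [hφ']
    have hline : Differentiable ℝ (fun t : ℝ => x + t • e) :=
      (differentiable_const x).add (differentiable_id.smul_const e)
    exact ((differentiable_const e).inner ℝ (hDW.comp hline)).differentiableAt
  -- first derivative of `t φ(t)`
  have h1 : deriv (fun t : ℝ => t * φ t) = fun t => φ t + t * deriv φ t := by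
    funext t
    have hmul := (hasDerivAt_id t).mul (hφd t)
    have hfun : (fun s : ℝ => s * φ s) = id * φ := by
      funext s
      rfl
    rw [hfun, hmul.deriv, (hφd t).deriv]
    simp only [one_mul, id_eq]
  rw [iteratedDeriv_succ, iteratedDeriv_one, h1]
  have h2 : HasDerivAt (fun t : ℝ => φ t + t * deriv φ t)
      (deriv φ 0 + (1 * deriv φ 0 + (0 : ℝ) * deriv (deriv φ) 0)) 0 :=
    ((hφd 0).differentiableAt.hasDerivAt).add ((hasDerivAt_id' (0 : ℝ)).mul hφ'd.hasDerivAt)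
  rw [h2.deriv, hφ']
  simp only [zero_smul, add_zero, one_mul, zero_mul]
  ring

/-- **Product rule for the Laplacian of `Ψ = ⟪· − x₀, W⟫`** (`W ∈ C²`): `ΔΨ(x) = 2 div W(x) + ⟪x − x₀, ΔW(x)⟫`. -/
theorem laplacian_inner_sub_eq (hW : ContDiff ℝ 2 W) (x₀ x : EuclideanSpace ℝ (Fin 3)) :
    Laplacian.laplacian (fun z : EuclideanSpace ℝ (Fin 3) => ⟪z - x₀, W z⟫) x
      = 2 * VectorCalculus.divergence W x + ⟪x - x₀, Laplacian.laplacian W x⟫ := by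
  have hΨ : ContDiff ℝ 2 (fun z : EuclideanSpace ℝ (Fin 3) => ⟪z - x₀, W z⟫) :=
    (contDiff_id.sub contDiff_const).inner ℝ hW
  rw [HorizonTower.laplacian_eq_sum_iteratedDeriv_line hΨ x,
    InnerProductSpace.laplacian_eq_iteratedFDeriv_orthonormalBasis W (EuclideanSpace.basisFun (Fin 3) ℝ),
    divergence_eq_sum_inner_fderiv (EuclideanSpace.basisFun (Fin 3) ℝ) W x, inner_sum, Finset.mul_sum,
    ← Finset.sum_add_distrib]
  refine Finset.sum_congr rfl fun m _ => ?_
  rw [EuclideanSpace.basisFun_apply]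
  set e : EuclideanSpace ℝ (Fin 3) := EuclideanSpace.single m (1 : ℝ) with he
  have hline : ContDiff ℝ 2 (fun t : ℝ => x + t • e) := contDiff_const.add (contDiff_id.smul contDiff_const)
  have hf₁ : ContDiff ℝ 2 (fun t : ℝ => ⟪x - x₀, W (x + t • e)⟫) := contDiff_const.inner ℝ (hW.comp hline)
  have hf₂ : ContDiff ℝ 2 (fun t : ℝ => t * ⟪e, W (x + t • e)⟫) :=
    contDiff_id.mul (contDiff_const.inner ℝ (hW.comp hline))
  have hsplit : (fun t : ℝ => ⟪x + t • e - x₀, W (x + t • e)⟫)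
      = (fun t : ℝ => ⟪x - x₀, W (x + t • e)⟫) + fun t : ℝ => t * ⟪e, W (x + t • e)⟫ := by
    funext t
    rw [Pi.add_apply, show x + t • e - x₀ = (x - x₀) + t • e by abel, inner_add_left, real_inner_smul_left]
  rw [hsplit, iteratedDeriv_add hf₁.contDiffAt hf₂.contDiffAt, iteratedDeriv_two_inner_const_line hW (x - x₀) x e,
    iteratedDeriv_two_mul_inner_line hW x e]
  ring

end LineCalculus

/-! ### Assembly -/

/-- ★ **(E1) `CentreVorticityJet`, body verbatim** (`IsUnthreadedAbout x₀ V` unfolded): if `V ∈ C³` is unthreaded about `x₀`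
then `curl V x₀ = 0`, `⟪y, ∇(curl V)(x₀) y⟫ = 0` for all `y`, and `Δ(curl V)(x₀) = 0`. -/
theorem centreVorticityJet :
    ∀ (V : EuclideanSpace ℝ (Fin 3) → EuclideanSpace ℝ (Fin 3)) (x₀ : EuclideanSpace ℝ (Fin 3)), ContDiff ℝ 3 V →
      (∀ x, inner ℝ (x - x₀) (curl V x) = 0) →
      curl V x₀ = 0 ∧ (∀ y : EuclideanSpace ℝ (Fin 3), inner ℝ y (fderiv ℝ (curl V) x₀ y) = 0) ∧
        Laplacian.laplacian (curl V) x₀ = 0 := by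
  intro V x₀ hV h
  have hω : ContDiff ℝ 2 (curl V) := by
    rw [curl_eq_curlCLM_comp]
    exact curlCLM.contDiff.comp (hV.fderiv_right (m := 2) (by norm_num))
  refine ⟨eq_zero_of_inner_sub_eq_zero hω.continuous.continuousAt h,
    inner_fderiv_self_eq_zero_of_inner_sub_eq_zero (hω.of_le (by norm_num)) h, ?_⟩
  -- `⟪x − x₀, Δω x⟫ = 0` everywhere: `ΔΨ = 0`, `div curl V = 0`
  have hdiv : ∀ x, VectorCalculus.divergence (curl V) x = 0 := fun x =>
    HelicityDensityTransport.divergence_curl_eq_zero_of_contDiffAt ((hV.of_le (by norm_num)).contDiffAt)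
  have hΨ0 : (fun z : EuclideanSpace ℝ (Fin 3) => ⟪z - x₀, curl V z⟫) = fun _ => (0 : ℝ) := funext h
  have hkey : ∀ x, ⟪x - x₀, Laplacian.laplacian (curl V) x⟫ = 0 := by
    intro x
    have e := laplacian_inner_sub_eq hω x₀ x
    rw [hΨ0, hdiv x, mul_zero, zero_add] at e
    rw [← e]
    simp
  -- `Δω` is continuous
  have hcont : Continuous (Laplacian.laplacian (curl V)) := by
    rw [InnerProductSpace.laplacian_eq_iteratedFDeriv_orthonormalBasis (curl V) (EuclideanSpace.basisFun (Fin 3) ℝ)]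
    refine continuous_finsetSum _ fun i _ => ?_
    exact (continuous_eval_const _).comp (hω.continuous_iteratedFDeriv le_rfl)
  exact eq_zero_of_inner_sub_eq_zero hcont.continuousAt hkey


end Summit.NavierStokesRegularity.NavierStokesRegularity.Theorems.PoloidalLiouville.CentreJet

end
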